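import Literature.NumberTheory.Automorphic.BaseChangeStrongUnramified
import Literature.NumberTheory.Automorphic.ReciprocityGLnRankOneProofs
import Literature.NumberTheory.Automorphic.AutomorphicRepsGLCleanModel
import Literature.NumberTheory.Automorphic.AshSmithTheoryHeckeLevelProofs
import Literature.NumberTheory.GaloisRepresentations.AdmissibleModulusGalois
import Literature.NumberTheory.GaloisRepresentations.UnramifiedLocalNorms
import Literature.NumberTheory.GaloisRepresentations.GlobalNormIndexIdelic
import HarnessLib

/-!
# Arthur–Clozel strong lifting at the unramified places: the case `n = 1` (proved)

Topic `NumberTheory/Automorphic`; proof file (theorems only: no definition, no named fact, no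
instance), companion of `BaseChangeStrongUnramified`, whose named fact
`ArthurClozel1989_strongLifting_unramified` (Arthur–Clozel, Ann. of Math. Stud. 120 (1989), Ch. 3,
Thm. 5.1 with the unramified local base change of Ch. 1 §6) is XL for `n ≥ 2` (the twisted trace
formula).  Here its **rank-one instance is proved outright**, in the tree's honest analytic model
(Borel–Jacquet data `CuspidalAutomorphicRepData 1 _ _`, weak lifting `IsWeakBaseChangeLiftAE`
through Satake parameters).

For `G = GL(1)` Shintani's character identity (Ch. 1, Def. 6.1: `trace (Π(g) I_σ) = trace π(𝒩 g)`)
reads `Π_w = π_v ∘ N_{E_w/F_v}`, and a weak lift `Π` of `π` has Hecke character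
`χ_Π = χ_π ∘ N_{E/F}` (rigidity of Hecke characters; the tree's
`AutomorphicRepData.heckeCharacter_eq_baseChange_of_isWeakBaseChangeLiftAE_glOne`), whose local
components ARE the `χ_{π,v} ∘ N_{E_w/F_v}` — Thm. 5.1 for `n = 1`.  Read on unramified data at a
finite place `v` of `F` unramified in `E` and `w ∣ v`: (i) if `χ_{π,v}` is unramified then so is
`χ_{Π,w} = χ_{π,v} ∘ N`, with `χ_{Π,w}(ϖ_w) = χ_{π,v}(ϖ_v)^{f(w|v)}` — relation (1.1); (ii) if
`χ_{Π,w}` is unramified for the `w ∣ v` then `χ_{π,v}` is trivial on `N(∏_{w∣v} 𝒪_wˣ) = 𝒪_vˣ`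
(the norm on local units above an UNRAMIFIED place is onto: Cassels–Fröhlich Ch. I §7, Childress
Lemma 5.3 (a); the tree's `SemiLocal.exists_unitGroup_norm_eq_algebraMap_of_isUnramifiedIn`), i.e.
unramified — the fibre of local base change for `GL(1)` is a torsor under the characters of
`F_vˣ / N E_wˣ`, unramified when `E_w/F_v` is (Ch. 1, Prop. 6.7).

## Contents (all proved)

* `exists_level_not_dvd` — splitting a level at a place: `𝔫₀ = 𝔭_w^k 𝔫` with `w ∤ 𝔫`, and every
  `g ∈ K(𝔫)` is `g₀ · ι_w(t)` with `g₀ ∈ K(𝔫₀)`, `t ∈ GL_n(𝒪_w)`.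
* `AutomorphicRepData.hasSatakeParamAt_glOne_of_isUnramifiedAt` — **for a `GL₁` datum `P = W/W'`
  with Hecke character `χ` unramified at `w`, `{χ(ϖ_w)}` is a Satake parameter of `P` at `w`**
  (a `K(𝔫)`-fixed form in `W ∖ W'` with `w ∤ 𝔫` is obtained by averaging a `K(𝔫₀)`-fixed one
  over the finite quotient `K(𝔫) / K(𝔫₀)`, on which `χ ∘ det = 1`); with the tree's converse
  `AutomorphicRepData.isUnramifiedAt_heckeCharacter_glOne` this is "`P` unramified at `w` iff `χ_P`
  is".
* `IdeleHerbrand.ideleRelNorm_ofBlock_eq_localUnits`, `HeckeCharacter.apply_ofBlock_eq_one` —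
  idelic bookkeeping: the norm of a block idele `ofBlock y` (`y ∈ ∏_{w∣v} 𝒪_wˣ` with semi-local
  norm `c ∈ 𝒪_vˣ` diagonally) is `⟨c⟩_v`, and a Hecke character unramified above `v` kills it.
* `HeckeCharacter.isUnramifiedAt_baseChange`, `HeckeCharacter.isUnramifiedAt_of_baseChange` —
  `χ ∘ N_{E/F}` is unramified above the unramified places of `χ`; conversely, at `v` unramified in
  `E`, `χ` is unramified at `v` as soon as `χ ∘ N_{E/F}` is unramified at every `w ∣ v`.
* `ArthurClozel1989_strongLifting_unramified.rank_one` — **the `n = 1` instance of the named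
  fact**, both clauses, for every finite Galois `E/F` (prime degree not needed in rank one).

## References

* J. Arthur, L. Clozel, *Simple algebras, base change, and the advanced theory of the trace
  formula*, Ann. of Math. Stud. 120 (1989): Ch. 1 §6.1 Def. 6.1 (book p. 51), Prop. 6.7; Ch. 3 §1
  (1.1), Def. 1.1–1.2 (p. 199), Thm. 5.1 (pp. 212–214). [ArthurClozelAMS120]
* J. W. S. Cassels, A. Fröhlich (eds.), *Algebraic Number Theory* (1967), Ch. I §7 (norms of units
  in unramified extensions), Ch. VII §4 Prop. 4.1. [CasselsFrohlichANT1967]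
* N. Childress, *Class Field Theory* (2009), Ch. 4 §5 Lemma 5.3 (a). [Childress2009]
* A. Borel, H. Jacquet, Corvallis (1979), Part 1, §4.6. [BorelJacquet1979]
-/

noncomputable section

open scoped MatrixGroups Matrix Classical NumberField
open NumberField IsDedekindDomain Filter
open _root_.Topology

namespace Literature.NumberTheory.Automorphic

open Literature.NumberTheory.GaloisRepresentations

/-! ### §1. Splitting a principal congruence level at one place -/

section Level

variable {K : Type} [Field K] [NumberField K]

/-- **Splitting a level at a place.**  For a non-zero ideal `𝔫₀ ⊆ 𝓞 K` and a finite place `w`,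
write `𝔫₀ = 𝔭_w^k 𝔫` with `w ∤ 𝔫` (`WfDvdMonoid.max_power_factor` in the monoid of ideals of the
Dedekind domain `𝓞 K`).  Then `𝔫 ≠ 0`, `𝔫₀ ⊆ 𝔫`, and every `g ∈ K(𝔫)` factors as
`g = g₀ · ι_w(t)` with `t = g_w ∈ GL_n(𝒪_w)` and `g₀ = g ι_w(t)⁻¹ ∈ K(𝔫₀)`: at `w` the component
of `g₀` is `1`, and at `u ≠ w` the radii `|𝔫₀|_u = |𝔫|_u` agree.  (Bump, *Automorphic forms and
representations*, §3.3: `K(𝔫) = ∏_u K_u(𝔫)`.) [folklore] -/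
theorem exists_level_not_dvd (n : ℕ) {𝔫₀ : Ideal (𝓞 K)} (h𝔫₀ : 𝔫₀ ≠ 0)
    (w : HeightOneSpectrum (𝓞 K)) :
    ∃ 𝔫 : Ideal (𝓞 K), 𝔫 ≠ 0 ∧ ¬ w.asIdeal ∣ 𝔫 ∧ 𝔫₀ ≤ 𝔫 ∧
      ∀ g ∈ principalCongruenceLevel n K 𝔫,
        ∃ t ∈ valuedCongruenceSubgroup (Fin n) (1 : WithZero (Multiplicative ℤ)),
          g * (GLn.ofLocal n K w t)⁻¹ ∈ principalCongruenceLevel n K 𝔫₀ := by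
  obtain ⟨k, 𝔫, hndvd, h𝔫₀eq⟩ := WfDvdMonoid.max_power_factor h𝔫₀ w.irreducible
  have h𝔫 : 𝔫 ≠ 0 := by
    rintro rfl
    rw [mul_zero] at h𝔫₀eq
    exact h𝔫₀ h𝔫₀eq
  refine ⟨𝔫, h𝔫, hndvd, ?_, fun g hg => ?_⟩
  · rw [h𝔫₀eq]
    exact Ideal.mul_le_left
  rw [mem_principalCongruenceLevel_iff] at hg
  -- the `w`-component `t = g_w ∈ GL_n(𝒪_w)` (`|𝔫|_w = 1`)
  set t : GL (Fin n) (w.adicCompletion K) :=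
    Matrix.GeneralLinearGroup.map (AdelicGroupData.adeleEval K w) g with htdef
  have ht : t ∈ valuedCongruenceSubgroup (Fin n) (1 : WithZero (Multiplicative ℤ)) := by
    have := hg.2 w
    rwa [idealRadius_eq_one_of_not_dvd h𝔫 hndvd] at this
  have h1 : Matrix.GeneralLinearGroup.map (AdelicGroupData.adeleEval K w) (GLn.ofLocal n K w t) = t :=
    GLn.toLocal_ofLocal t
  have h2 : ∀ {u : HeightOneSpectrum (𝓞 K)}, u ≠ w →
      Matrix.GeneralLinearGroup.map (AdelicGroupData.adeleEval K u) (GLn.ofLocal n K w t) = 1 :=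
    fun hu => GLn.toLocal_ofLocal_of_ne hu t
  refine ⟨t, ht, ?_⟩
  rw [mem_principalCongruenceLevel_iff]
  refine ⟨mul_mem hg.1 (inv_mem (isMaximalAt_glIntegralLevel n K w ⟨_, ht, rfl⟩)), fun u => ?_⟩
  change Matrix.GeneralLinearGroup.map (AdelicGroupData.adeleEval K u) (g * (GLn.ofLocal n K w t)⁻¹) ∈
    valuedCongruenceSubgroup (Fin n) (idealRadius K u 𝔫₀)
  rw [map_mul, map_inv]
  by_cases hu : u = w
  · subst hu
    rw [h1, ← htdef, mul_inv_cancel]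
    exact one_mem _
  · rw [h2 hu, inv_one, mul_one]
    have hrad : idealRadius K u 𝔫₀ = idealRadius K u 𝔫 := by
      unfold idealRadius
      rw [h𝔫₀eq, FractionalIdeal.coeIdeal_mul, FractionalIdeal.coeIdeal_pow,
        FractionalIdeal.count_mul K u (pow_ne_zero _ (FractionalIdeal.coeIdeal_ne_zero.mpr w.ne_bot))
          (FractionalIdeal.coeIdeal_ne_zero.mpr h𝔫),
        FractionalIdeal.count_pow, FractionalIdeal.count_maximal_coprime K u (fun h : w = u => hu h.symm),
        mul_zero, zero_add]
    rw [hrad]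
    exact hg.2 u

end Level

/-! ### §2. `GL₁` data: unramified Hecke character ⟹ Satake parameter -/

section GLOne

variable {K : Type} [Field K] [NumberField K] {hcpt : isCompact_glFiniteIntegralLevel 1 K}

/-- **For a `GL₁` datum whose Hecke character is unramified at `w`, `{χ(ϖ_w)}` is a Satake
parameter at `w`.**  Let `P = W / W'` be an automorphic representation of `GL₁(𝔸_K)`
(Borel–Jacquet datum) with Hecke character `χ` (`r(g) φ - χ(det g) φ ∈ W'`), and suppose `χ` is
unramified at the finite place `w`.  Then for every uniformizer `ϖ` of `K_w`, `P` has Satake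
parameter `{χ(⟨ϖ⟩_w)}` at `w`.  Proof: a form `φ₀ ∈ W ∖ W'` is fixed by some `K(𝔫₀)`
(`AutomorphicRepData.exists_principalCongruenceLevel_fixed`); split `𝔫₀ = 𝔭_w^k 𝔫`, `w ∤ 𝔫`
(`exists_level_not_dvd`); every `g ∈ K(𝔫)` is `g₀ ι_w(t)` with `g₀ ∈ K(𝔫₀)` fixing `φ₀` and
`ι_w(t)`, `t ∈ 𝒪_wˣ`, acting by `χ(⟨t⟩_w) = 1` modulo `W'`, so `r(g) φ₀ ≡ φ₀ (mod W')`; the average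
`φ₁ = ∑_{q ∈ K(𝔫)/N} r(q) φ₀` over a finite-index `N ≤ K(𝔫) ∩ K(𝔫₀)`
(`finiteIndex_subgroupOf_principalCongruenceLevel`, `subgroupQuotientSum_apply_mem_fixedPoints`) is a
`K(𝔫)`-fixed form of `W` with `φ₁ ≡ [K(𝔫):N] φ₀ ≢ 0 (mod W')`, and
`AutomorphicRepData.hasSatakeParamAt_glOne_of_fixed` applies.  (Tate 1950, §2.3: unramified
quasi-characters; Borel–Jacquet 1979, 4.6.) [cite: BorelJacquet1979, 4.6] -/
theorem AutomorphicRepData.hasSatakeParamAt_glOne_of_isUnramifiedAt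
    (π : AutomorphicRepData (AutomorphyDatum.gl 1 K hcpt)) {χ : HeckeCharacter K}
    (hχ : ∀ (g : (AdelicGroupData.gl 1 K).Adelic), ∀ φ ∈ π.W,
      rightTranslation (AdelicGroupData.gl 1 K) g φ -
        ((χ (Matrix.GeneralLinearGroup.det g) : ℂˣ) : ℂ) • φ ∈ π.W')
    {w : HeightOneSpectrum (𝓞 K)} (hw : χ.IsUnramifiedAt w) {ϖ : (w.adicCompletion K)ˣ}
    (hϖ : Valued.v (ϖ : w.adicCompletion K) = WithZero.exp (-1 : ℤ)) :
    π.HasSatakeParamAt w {((χ (localUnits w ϖ) : ℂˣ) : ℂ)} := by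
  -- a form fixed by some level `K(𝔫₀)`, and the level split at `w`
  obtain ⟨𝔫₀, h𝔫₀, φ₀, hφ₀W, hφ₀W', hfix₀⟩ := π.exists_principalCongruenceLevel_fixed
  obtain ⟨𝔫, h𝔫, hndvd, -, hsplit⟩ := exists_level_not_dvd 1 h𝔫₀ w
  -- Step 1: `K(𝔫)` fixes `φ₀` modulo `W'`
  have hmod : ∀ g : (AdelicGroupData.gl 1 K).Adelic, g ∈ principalCongruenceLevel 1 K 𝔫 →
      rightTranslation (AdelicGroupData.gl 1 K) g φ₀ - φ₀ ∈ π.W' := by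
    intro g hg
    obtain ⟨t, ht, hg₀⟩ := hsplit g hg
    rw [mem_valuedCongruenceSubgroup_iff] at ht
    set s : (AdelicGroupData.gl 1 K).Adelic := GLn.ofLocal 1 K w t with hsdef
    -- `χ(det ι_w(t)) = χ(⟨det t⟩_w) = 1`, `det t ∈ 𝒪_wˣ`
    have hdet : χ (Matrix.GeneralLinearGroup.det s) = 1 := by
      set U : (w.adicCompletion K)ˣ := Matrix.GeneralLinearGroup.det t with hUdef
      have hU1 : Valued.v (U : w.adicCompletion K) ≤ 1 := by
        rw [hUdef, Matrix.GeneralLinearGroup.val_det_apply, Matrix.det_fin_one]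
        exact ht.1 0 0
      have hU2 : Valued.v ((U⁻¹ : (w.adicCompletion K)ˣ) : w.adicCompletion K) ≤ 1 := by
        rw [hUdef, ← map_inv, Matrix.GeneralLinearGroup.val_det_apply, Matrix.det_fin_one]
        exact ht.2.1 0 0
      set uO : (w.adicCompletionIntegers K)ˣ :=
        ⟨⟨(U : w.adicCompletion K), (HeightOneSpectrum.mem_adicCompletionIntegers (R := 𝓞 K) K w).mpr hU1⟩,
          ⟨((U⁻¹ : (w.adicCompletion K)ˣ) : w.adicCompletion K),
            (HeightOneSpectrum.mem_adicCompletionIntegers (R := 𝓞 K) K w).mpr hU2⟩,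
          Subtype.ext U.mul_inv, Subtype.ext U.inv_mul⟩ with huOdef
      have huO : Units.map ((w.adicCompletionIntegers K).subtype : _ →* _) uO = U := Units.ext rfl
      have hs : s = Matrix.GeneralLinearGroup.scalar (Fin 1) (localUnits w U) := by
        rw [scalar_localUnits_eq_ofLocal, hUdef, generalLinearGroup_scalar_det_of_fin_one]
      have h1 := hw uO
      rw [HeckeCharacter.localComponent_apply, huO] at h1
      rw [hs, det_generalLinearGroup_scalar_fin_one]
      exact h1
    have h1 : rightTranslation (AdelicGroupData.gl 1 K) s φ₀ - φ₀ ∈ π.W' := by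
      have := hχ s φ₀ hφ₀W
      rwa [hdet, Units.val_one, one_smul] at this
    have h2 : rightTranslation (AdelicGroupData.gl 1 K) (g * s⁻¹) φ₀ = φ₀ := hfix₀ _ hg₀
    have h3 : rightTranslation (AdelicGroupData.gl 1 K) g φ₀ =
        rightTranslation (AdelicGroupData.gl 1 K) (g * s⁻¹)
          (rightTranslation (AdelicGroupData.gl 1 K) s φ₀) := by
      rw [← Module.End.mul_apply, ← map_mul, inv_mul_cancel_right]
    have h4 : rightTranslation (AdelicGroupData.gl 1 K) g φ₀ - φ₀ =
        rightTranslation (AdelicGroupData.gl 1 K) (g * s⁻¹)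
          (rightTranslation (AdelicGroupData.gl 1 K) s φ₀ - φ₀) := by
      rw [map_sub, h2, h3]
    rw [h4]
    exact π.stable'.rightTranslation_mem_glOne _ h1
  -- Step 2: average over the finite quotient `K(𝔫) / N`, `N = K(𝔫) ∩ K(𝔫₀)`
  set Kn : Subgroup (AdelicGroupData.gl 1 K).Adelic := principalCongruenceLevel 1 K 𝔫 with hKn
  set N : Subgroup Kn :=
    (((principalCongruenceLevel 1 K 𝔫₀).comap (GLn.ofFinite 1 K)).comap (GLn.sndHom 1 K)).subgroupOf Kn
    with hNdef
  haveI : N.FiniteIndex := finiteIndex_subgroupOf_principalCongruenceLevel h𝔫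
    (isOpen_comap_ofFinite_principalCongruenceLevel 1 K h𝔫₀)
  have hN : ∀ m : Kn, m ∈ N →
      rightTranslation (AdelicGroupData.gl 1 K) (m : (AdelicGroupData.gl 1 K).Adelic) φ₀ = φ₀ := by
    intro m hm
    apply hfix₀
    have hm' : GLn.ofFinite 1 K (GLn.sndHom 1 K m.1) ∈
        principalCongruenceLevel 1 K 𝔫₀ := hm
    rwa [GLn.ofFinite_sndHom_of_mem (principalCongruenceLevel_le 1 K 𝔫 m.2)] at hm'
  have havg := subgroupQuotientSum_apply_mem_fixedPoints (rightTranslation (AdelicGroupData.gl 1 K))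
    Kn N hN
  set φ₁ := (∑ᶠ q : Kn ⧸ N, rightTranslation (AdelicGroupData.gl 1 K)
    ((q.out : Kn) : (AdelicGroupData.gl 1 K).Adelic)) φ₀ with hφ₁
  haveI : Fintype (Kn ⧸ N) := Fintype.ofFinite _
  have hφ₁sum : φ₁ = ∑ q : Kn ⧸ N, rightTranslation (AdelicGroupData.gl 1 K)
      ((q.out : Kn) : (AdelicGroupData.gl 1 K).Adelic) φ₀ := by
    rw [hφ₁, finsum_eq_sum_of_fintype, LinearMap.sum_apply]
  have hφ₁W : φ₁ ∈ π.W := by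
    rw [hφ₁sum]
    exact π.W.sum_mem fun q _ => π.stable.rightTranslation_mem_glOne _ hφ₀W
  have hdiff : φ₁ - (Fintype.card (Kn ⧸ N) : ℂ) • φ₀ ∈ π.W' := by
    have : φ₁ - (Fintype.card (Kn ⧸ N) : ℂ) • φ₀ = ∑ q : Kn ⧸ N,
        (rightTranslation (AdelicGroupData.gl 1 K) ((q.out : Kn) : (AdelicGroupData.gl 1 K).Adelic) φ₀ - φ₀) := by
      rw [Finset.sum_sub_distrib, Finset.sum_const, Finset.card_univ, ← Nat.cast_smul_eq_nsmul ℂ,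
        hφ₁sum]
    rw [this]
    exact π.W'.sum_mem fun q _ => hmod _ (q.out).2
  have hφ₁W' : φ₁ ∉ π.W' := by
    intro h
    apply hφ₀W'
    have hc : (Fintype.card (Kn ⧸ N) : ℂ) ≠ 0 := Nat.cast_ne_zero.mpr Fintype.card_ne_zero
    have hmem : (Fintype.card (Kn ⧸ N) : ℂ) • φ₀ ∈ π.W' := by
      have := π.W'.sub_mem h hdiff
      rwa [sub_sub_cancel] at this
    exact (π.W'.smul_mem_iff hc).mp hmem
  have hfix₁ : ∀ u ∈ principalCongruenceLevel 1 K 𝔫,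
      rightTranslation (AdelicGroupData.gl 1 K) u φ₁ = φ₁ := by
    intro u hu
    rw [Representation.mem_fixedPoints] at havg
    exact havg u hu
  exact π.hasSatakeParamAt_glOne_of_fixed hχ h𝔫 hφ₁W hφ₁W' hfix₁ hndvd hϖ

/-- **On `GL₁`, the datum is unramified exactly where its Hecke character is**: `P = W/W'` has a
Satake parameter at `w` iff `χ_P` is trivial on `𝒪_wˣ` (`AutomorphicRepData.isUnramifiedAt_heckeCharacter_glOne`
and `hasSatakeParamAt_glOne_of_isUnramifiedAt`).  Tate 1950, §2.3; Borel–Jacquet 1979, 4.6.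
[cite: BorelJacquet1979, 4.6] -/
theorem AutomorphicRepData.isUnramifiedAt_iff_heckeCharacter_glOne
    (π : AutomorphicRepData (AutomorphyDatum.gl 1 K hcpt)) {χ : HeckeCharacter K}
    (hχ : ∀ (g : (AdelicGroupData.gl 1 K).Adelic), ∀ φ ∈ π.W,
      rightTranslation (AdelicGroupData.gl 1 K) g φ -
        ((χ (Matrix.GeneralLinearGroup.det g) : ℂˣ) : ℂ) • φ ∈ π.W')
    (w : HeightOneSpectrum (𝓞 K)) : π.IsUnramifiedAt w ↔ χ.IsUnramifiedAt w := by
  refine ⟨fun ⟨α, hα⟩ => π.isUnramifiedAt_heckeCharacter_glOne hχ hα, fun hw => ?_⟩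
  exact ⟨_, π.hasSatakeParamAt_glOne_of_isUnramifiedAt hχ hw (HeckeCharacter.valued_uniformizer (K := K) w)⟩

end GLOne

/-! ### §3. Idelic bookkeeping: norms of block ideles, Hecke characters on blocks -/

section Blocks

variable {F E : Type} [Field F] [NumberField F] [Field E] [NumberField E] [Algebra F E]

/-- Units of `𝒪_w` have valuation `1` in `E_w`. [folklore] -/
private theorem valued_unitsMap_subtype_eq_one {w : HeightOneSpectrum (𝓞 E)}
    (uO : (w.adicCompletionIntegers E)ˣ) :
    Valued.v ((Units.map ((w.adicCompletionIntegers E).subtype : _ →* _) uO :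
      (w.adicCompletion E)ˣ) : w.adicCompletion E) = 1 :=
  Valuation.Integers.one_of_isUnit' (v := (Valued.v : Valuation (w.adicCompletion E) _))
    (O := w.adicCompletionIntegers E) uO.isUnit fun x => x.2

variable [IsGalois F E]

/-- **The idelic norm of a block of local units.**  Let `x ∈ ∏_{w∣v} 𝒰_w ⊆ J_E` (ideles of `E`
trivial at infinity and away from `v`, local units above `v`) and suppose the semi-local norm
`∏_σ σ • x_v` of its block above `v` is `c ∈ 𝒪_vˣ` diagonally.  Then `N_{E/F}(x) = ⟨c⟩_v`: both
`(⟨c⟩_v)_E` and `∏_σ σ • x` lie in `∏_{w∣v} 𝒰_w`, on which the block projection is injective, and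
have the same block (the argument of `localUnits_mem_idelicNormSubgroup_of_norm_eq_algebraMap`,
`AdmissibleModulusGalois`). [cite: CasselsFrohlichANT1967, Ch. VII §2] -/
theorem ideleRelNorm_eq_localUnits_of_norm_blockHom_eq {v : HeightOneSpectrum (𝓞 F)}
    {x : ideleGroup E} (hx : x ∈ IdeleHerbrand.localUnitIdeles F E v)
    {c : (v.adicCompletion F)ˣ} (hc : Valued.v (c : v.adicCompletion F) = 1)
    (h : ((Herbrand.norm (E ≃ₐ[F] E) (IdeleHerbrand.blockHom F E v x) : (SemiLocal F E v)ˣ) :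
        SemiLocal F E v) = algebraMap (v.adicCompletion F) (SemiLocal F E v) c) :
    AdeleRing.ideleRelNorm F E x = localUnits v c := by
  haveI : FiniteDimensional F E := Module.Finite.of_restrictScalars_finite ℚ F E
  rw [AdeleRing.ideleRelNorm_eq_iff, ← IdeleHerbrand.norm_eq_ideleGalNorm]
  set X := AdeleRing.ideleBaseChange F E (localUnits v c) with hXdef
  have hX : X ∈ IdeleHerbrand.localUnitIdeles F E v :=
    ideleBaseChange_localUnits_mem_localUnitIdeles E v hc
  have hN : Herbrand.norm (E ≃ₐ[F] E) x ∈ IdeleHerbrand.localUnitIdeles F E v :=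
    IdeleHerbrand.isStable_localUnitIdeles.norm_mem hx
  have hblk : IdeleHerbrand.blockHom F E v (Herbrand.norm (E ≃ₐ[F] E) x) =
      IdeleHerbrand.blockHom F E v X := by
    apply Units.ext
    rw [IdeleHerbrand.blockHom_norm, h, hXdef, coe_blockHom_ideleBaseChange_localUnits]
  have hmem : Herbrand.norm (E ≃ₐ[F] E) x * X⁻¹ ∈
      IdeleHerbrand.localUnitIdeles F E v ⊓ (IdeleHerbrand.blockHom F E v).ker := by
    refine Subgroup.mem_inf.mpr ⟨(IdeleHerbrand.localUnitIdeles F E v).mul_mem hN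
      ((IdeleHerbrand.localUnitIdeles F E v).inv_mem hX), ?_⟩
    rw [MonoidHom.mem_ker, map_mul, map_inv, hblk, mul_inv_cancel]
  rw [IdeleHerbrand.localUnitIdeles_inf_ker_blockHom, Subgroup.mem_bot] at hmem
  exact (mul_inv_eq_one.mp hmem).symm

omit [IsGalois F E] in
/-- **A Hecke character unramified above `v` kills the block ideles above `v`**: if `χ` is
unramified at every `w ∣ v` then `χ(x) = 1` for the idele `x = ofBlock y` with block
`y ∈ ∏_{w∣v} 𝒪_wˣ` and `1` elsewhere (`x = ∏_{w∣v} ⟨y_w⟩_w`, `snd_prod_localUnits`).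
[cite: TateThesis1967, §4.3] -/
theorem _root_.Literature.NumberTheory.GaloisRepresentations.HeckeCharacter.apply_ofBlock_eq_one
    (χ : HeckeCharacter E) {v : HeightOneSpectrum (𝓞 F)}
    (hχ : ∀ w : HeightOneSpectrum (𝓞 E), w.under (𝓞 F) = v → χ.IsUnramifiedAt w)
    {y : (SemiLocal F E v)ˣ} (hy : y ∈ SemiLocal.unitGroup F E v) :
    χ (IdeleHerbrand.ofBlock y hy) = 1 := by
  classical
  have hT : {w : HeightOneSpectrum (𝓞 E) | w.under (𝓞 F) = v}.Finite :=
    Set.finite_coe_iff.mp (inferInstance : Finite (SemiLocal.Place F E v))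
  -- the unit components of `y`, extended by `1`
  set c : ∀ q : HeightOneSpectrum (𝓞 E), (q.adicCompletion E)ˣ := fun q =>
    if h : q.under (𝓞 F) = v then
      Units.map (Pi.evalMonoidHom (fun w : SemiLocal.Place F E v =>
        (w : HeightOneSpectrum (𝓞 E)).adicCompletion E) ⟨q, h⟩) y
    else 1 with hcdef
  have hc : ∀ {q : HeightOneSpectrum (𝓞 E)} (h : q.under (𝓞 F) = v),
      (c q : q.adicCompletion E) = (y : SemiLocal F E v) ⟨q, h⟩ := by
    intro q h
    rw [hcdef]
    simp only [dif_pos h, Units.coe_map]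
    rfl
  -- `ofBlock y = ∏_{w ∣ v} ⟨y_w⟩_w`
  have hprod : IdeleHerbrand.ofBlock y hy = ∏ q ∈ hT.toFinset, localUnits q (c q) := by
    apply Units.ext
    refine Prod.ext ?_ (FiniteAdeleRing.ext E fun w => ?_)
    · rw [IdeleHerbrand.ofBlock_fst, fst_prod_localUnits]
    · rw [snd_prod_localUnits]
      by_cases hw : w.under (𝓞 F) = v
      · rw [IdeleHerbrand.ofBlock_snd_apply_of_eq y hy hw, if_pos (hT.mem_toFinset.mpr hw), hc hw]
      · rw [IdeleHerbrand.ofBlock_snd_apply_of_ne y hy hw,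
          if_neg (fun h => hw (hT.mem_toFinset.mp h))]
  rw [hprod, map_prod]
  refine Finset.prod_eq_one fun q hq => ?_
  have hqv : q.under (𝓞 F) = v := hT.mem_toFinset.mp hq
  refine (hχ q hqv).map_localUnits_eq_one _ ?_
  rw [hc hqv]
  exact hy ⟨q, hqv⟩

end Blocks

/-! ### §4. Ramification of `χ ∘ N_{E/F}` -/

section BaseChange

variable {F E : Type} [Field F] [NumberField F] [Field E] [NumberField E] [Algebra F E]
  [IsGalois F E]

/-- **`χ ∘ N_{E/F}` is unramified above the unramified places of `χ`.**  For `w ∣ v` and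
`u ∈ 𝒪_wˣ`, `N_{E/F}(⟨u⟩_w) = ⟨c⟩_v` with `c = N_{E_w/F_v}(u) ∈ 𝒪_vˣ` (the semi-local norm of
the block of `⟨u⟩_w` is a `Gal(E/F)`-fixed unit, hence diagonal), so
`χ_E(⟨u⟩_w) = χ(⟨c⟩_v) = 1`.  For `GL(1)` this is "the lift of an unramified character is
unramified" (Arthur–Clozel, Ch. 1 §6.2; Ch. 3 §1 (1.1)). [cite: ArthurClozelAMS120, Ch. 3, §1 (1.1)] -/
theorem _root_.Literature.NumberTheory.GaloisRepresentations.HeckeCharacter.isUnramifiedAt_baseChange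
    (χ : HeckeCharacter F) {v : HeightOneSpectrum (𝓞 F)} (hv : χ.IsUnramifiedAt v)
    {w : HeightOneSpectrum (𝓞 E)} (hw : w.under (𝓞 F) = v) :
    (χ.baseChange E).IsUnramifiedAt w := by
  intro uO
  set u : (w.adicCompletion E)ˣ :=
    Units.map ((w.adicCompletionIntegers E).subtype : _ →* _) uO with hudef
  have hu : Valued.v (u : w.adicCompletion E) = 1 := valued_unitsMap_subtype_eq_one uO
  -- `⟨u⟩_w ∈ ∏_{w'∣v} 𝒰_{w'}`
  have hx : localUnits w u ∈ IdeleHerbrand.localUnitIdeles F E v := by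
    refine ⟨localUnits_fst w u, fun w' hw' => ?_, fun w' => ?_⟩
    · exact localUnits_snd_apply_of_ne _ (fun h => hw' (h ▸ hw))
    · by_cases h : w' = w
      · subst h
        rw [localUnits_snd_apply_self]
        exact hu
      · rw [localUnits_snd_apply_of_ne _ h, map_one]
  -- the semi-local norm of its block is a fixed unit, hence `c ∈ 𝒪_vˣ` diagonally
  have hyN : Herbrand.norm (E ≃ₐ[F] E) (IdeleHerbrand.blockHom F E v (localUnits w u)) ∈
      SemiLocal.unitGroup F E v :=
    SemiLocal.isStable_unitGroup.norm_mem (IdeleHerbrand.blockHom_mem_unitGroup hx)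
  obtain ⟨c, hc1, hc⟩ := SemiLocal.exists_eq_algebraMap_of_fixed_unit hyN
    (fun σ => Herbrand.smul_norm σ _)
  have hc0 : c ≠ 0 := fun h0 => by
    rw [h0, map_zero] at hc1
    exact zero_ne_one hc1
  have hrel := ideleRelNorm_eq_localUnits_of_norm_blockHom_eq hx (c := Units.mk0 c hc0) hc1 hc.symm
  rw [HeckeCharacter.localComponent_apply, HeckeCharacter.baseChange_apply, hrel]
  exact hv.map_localUnits_eq_one _ hc1

/-- **Descent of unramifiedness along `χ ↦ χ ∘ N_{E/F}` at a place unramified in `E/F`.**  If `v`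
is unramified in `E` and `χ ∘ N_{E/F}` is unramified at every `w ∣ v`, then `χ` is unramified at
`v`: every `u ∈ 𝒪_vˣ` is, diagonally, the semi-local norm of some `y ∈ ∏_{w∣v} 𝒪_wˣ` (the norm
on the units of an UNRAMIFIED extension is onto —
`SemiLocal.exists_unitGroup_norm_eq_algebraMap_of_isUnramifiedIn`; Cassels–Fröhlich Ch. I §7,
Childress Lemma 5.3 (a)), so `⟨u⟩_v = N_{E/F}(x)` for the block idele `x = ofBlock y`, and
`χ(⟨u⟩_v) = χ_E(x) = 1`.  For `GL(1)` this is the unramified case of the description of the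
fibres of local base change (Arthur–Clozel, Ch. 1, Prop. 6.7: the fibre is a torsor under the
characters of `F_vˣ / N E_wˣ`, which are unramified when `E_w/F_v` is).
[cite: ArthurClozelAMS120, Ch. 1, Prop. 6.7] [cite: Childress2009, Ch. 4 §5 Lemma 5.3 (PDF p. 95)] -/
theorem _root_.Literature.NumberTheory.GaloisRepresentations.HeckeCharacter.isUnramifiedAt_of_baseChange
    (χ : HeckeCharacter F) {v : HeightOneSpectrum (𝓞 F)}
    (hunr : Algebra.IsUnramifiedIn (𝓞 E) v.asIdeal)
    (h : ∀ w : HeightOneSpectrum (𝓞 E), w.under (𝓞 F) = v → (χ.baseChange E).IsUnramifiedAt w) :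
    χ.IsUnramifiedAt v := by
  intro uO
  set u : (v.adicCompletion F)ˣ :=
    Units.map ((v.adicCompletionIntegers F).subtype : _ →* _) uO with hudef
  have hu : Valued.v (u : v.adicCompletion F) = 1 := valued_unitsMap_subtype_eq_one uO
  obtain ⟨y, hy, hNy⟩ := SemiLocal.exists_unitGroup_norm_eq_algebraMap_of_isUnramifiedIn
    (E := E) hunr hu
  have hx := IdeleHerbrand.ofBlock_mem y hy
  have hrel : AdeleRing.ideleRelNorm F E (IdeleHerbrand.ofBlock y hy) = localUnits v u :=
    ideleRelNorm_eq_localUnits_of_norm_blockHom_eq hx hu (by rwa [IdeleHerbrand.blockHom_ofBlock])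
  have h1 : χ.baseChange E (IdeleHerbrand.ofBlock y hy) = 1 := (χ.baseChange E).apply_ofBlock_eq_one h hy
  rw [HeckeCharacter.baseChange_apply, hrel] at h1
  rw [HeckeCharacter.localComponent_apply]
  exact h1

end BaseChange

/-! ### §5. Arthur–Clozel's strong lifting at the unramified places for `n = 1` -/

section RankOne

variable {F E : Type} [Field F] [NumberField F] [Field E] [NumberField E] [Algebra F E]
  [IsGalois F E] {hF : isCompact_glFiniteIntegralLevel 1 F} {hE : isCompact_glFiniteIntegralLevel 1 E}

omit [NumberField F] [NumberField E] [IsGalois F E] in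
/-- The two spellings of `w ∣ v`. [folklore] -/
private theorem under_eq_iff_asIdeal {w : HeightOneSpectrum (𝓞 E)} {v : HeightOneSpectrum (𝓞 F)} :
    w.under (𝓞 F) = v ↔ w.asIdeal.under (𝓞 F) = v.asIdeal := by
  rw [HeightOneSpectrum.ext_iff, HeightOneSpectrum.under_asIdeal]

/-- **Relation (1.1) at EVERY finite place over an unramified `v`, for `GL₁` (clause (i) of
Arthur–Clozel's strong lifting in rank one).**  Let `π = W/W'` on `GL₁(𝔸_F)` and `Π` on
`GL₁(𝔸_E)` be automorphic representation data with `Π` a weak base-change lift of `π`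
(`IsWeakBaseChangeLiftAE`), `E/F` Galois.  Then `Π` is an unramified strong lift of `π`
(`IsUnramifiedBaseChangeLift`): at `w ∣ v` with `v` unramified in `E` and `α = {χ_π(ϖ_v)}` a
Satake parameter of `π` at `v`, `χ_Π = χ_π ∘ N_{E/F}` is unramified at `w`
(`HeckeCharacter.isUnramifiedAt_baseChange`), so `{χ_Π(ϖ')}` is a Satake parameter of `Π` at `w`
for the image `ϖ'` of `ϖ_v` (a uniformizer, `e(w|v) = 1`), and `χ_Π(ϖ') = χ_π(ϖ_v)^{f(w|v)}`
(`HeckeCharacter.baseChange_localUnits`).  Arthur–Clozel, Ch. 3, Thm. 5.1 with §1 (1.1) and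
Ch. 1 Def. 6.1, for `n = 1`. [cite: ArthurClozelAMS120, Ch. 3 Thm. 5.1 with §1 (1.1)] -/
theorem AutomorphicRepData.isUnramifiedBaseChangeLift_of_isWeakBaseChangeLiftAE_glOne
    (π : AutomorphicRepData (AutomorphyDatum.gl 1 F hF))
    (P : AutomorphicRepData (AutomorphyDatum.gl 1 E hE)) (hBC : IsWeakBaseChangeLiftAE π P) :
    IsUnramifiedBaseChangeLift π P := by
  intro w v α hwv hvE hα
  -- Hecke characters, `χ_Π = χ_π ∘ N_{E/F}`
  obtain ⟨χπ, hχπ⟩ := π.exists_heckeCharacter_glOne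
  obtain ⟨χP, hχP⟩ := P.exists_heckeCharacter_glOne
  have hbc : χP = χπ.baseChange E :=
    AutomorphicRepData.heckeCharacter_eq_baseChange_of_isWeakBaseChangeLiftAE_glOne hχπ hχP hBC
  -- `α = {χ_π(ϖ_v)}` and `χ_π` is unramified at `v`
  have hurπ : χπ.IsUnramifiedAt v := π.isUnramifiedAt_heckeCharacter_glOne hχπ hα
  obtain ⟨ϖ, hϖ, rfl⟩ := π.exists_eq_singleton_of_hasSatakeParamAt_glOne hχπ hα
  -- `w ∣ v`, `e(w|v) = 1`, `f(w|v)`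
  have hwv' : w.under (𝓞 F) = v := under_eq_iff_asIdeal.mpr hwv
  haveI iw : w.asIdeal.LiesOver v.asIdeal := ⟨hwv.symm⟩
  haveI : IsGaloisGroup (E ≃ₐ[F] E) (𝓞 F) (𝓞 E) := IsGaloisGroup.of_isFractionRing _ _ _ F E
  have he : w.asIdeal.ramificationIdx (𝓞 F) = 1 := by
    rw [← Ideal.ramificationIdxIn_eq_ramificationIdx v.asIdeal w.asIdeal (E ≃ₐ[F] E)]
    exact ramificationIdxIn_eq_one_of_isUnramifiedIn hvE
  have he' : v.asIdeal.ramificationIdx' w.asIdeal = 1 := by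
    rw [Ideal.ramificationIdx'_eq_ramificationIdx v.asIdeal w.asIdeal v.ne_bot, he]
  have heIn : v.asIdeal.ramificationIdxIn (𝓞 E) = 1 := by
    rw [Ideal.ramificationIdxIn_eq_ramificationIdx v.asIdeal w.asIdeal (E ≃ₐ[F] E), he]
  have hfIn : v.asIdeal.inertiaDegIn (𝓞 E) = w.asIdeal.inertiaDeg (𝓞 F) :=
    Ideal.inertiaDegIn_eq_inertiaDeg v.asIdeal w.asIdeal (E ≃ₐ[F] E)
  -- the image `ϖ'` of `ϖ_v` in `E_w` is a uniformizer
  obtain ⟨c, hc, -⟩ := exists_localUnitsAbove E v ϖ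
  have hϖ' : Valued.v ((c w : (w.adicCompletion E)ˣ) : w.adicCompletion E) = WithZero.exp (-1 : ℤ) := by
    rw [hc w hwv', valued_adicCompletionOfLiesOver, he', pow_one, hϖ]
  -- `χ_Π` is unramified at `w`: `{χ_Π(ϖ')}` is a Satake parameter of `Π` at `w`
  have hurP : χP.IsUnramifiedAt w := by
    rw [hbc]
    exact χπ.isUnramifiedAt_baseChange hurπ hwv'
  have hP := P.hasSatakeParamAt_glOne_of_isUnramifiedAt hχP hurP hϖ'
  -- `χ_Π(ϖ') = χ_π(ϖ_v)^{f(w|v)}`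
  have hval : ((χP (localUnits w (c w)) : ℂˣ) : ℂ) =
      ((χπ (localUnits v ϖ) : ℂˣ) : ℂ) ^ w.asIdeal.inertiaDeg (𝓞 F) := by
    rw [hbc, HeckeCharacter.baseChange_localUnits E χπ v ϖ c hc hwv', heIn, one_mul, hfIn,
      Units.val_pow_eq_pow_val]
  rw [Multiset.map_singleton, ← hval]
  exact hP

/-- **Descent of unramifiedness over an unramified `v`, for `GL₁` (clause (ii) of Arthur–Clozel's
strong lifting in rank one).**  With `π`, `Π` as above (`Π` a weak base-change lift of `π`, `E/F`
Galois): if `v` is unramified in `E` and `Π` is unramified at every `w ∣ v`, then `π` is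
unramified at `v` — `χ_Π = χ_π ∘ N_{E/F}` is unramified at the `w ∣ v`
(`AutomorphicRepData.isUnramifiedAt_heckeCharacter_glOne`), hence `χ_π` is unramified at `v`
(`HeckeCharacter.isUnramifiedAt_of_baseChange`: the norm on the units above an unramified place is
onto), hence `π` is (`AutomorphicRepData.hasSatakeParamAt_glOne_of_isUnramifiedAt`).
Arthur–Clozel, Ch. 3, Thm. 5.1 with Ch. 1, Prop. 6.7, for `n = 1`.
[cite: ArthurClozelAMS120, Ch. 3 Thm. 5.1; Ch. 1 Prop. 6.7] -/
theorem AutomorphicRepData.isUnramifiedAt_of_isWeakBaseChangeLiftAE_glOne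
    (π : AutomorphicRepData (AutomorphyDatum.gl 1 F hF))
    (P : AutomorphicRepData (AutomorphyDatum.gl 1 E hE)) (hBC : IsWeakBaseChangeLiftAE π P)
    {v : HeightOneSpectrum (𝓞 F)} (hvE : Algebra.IsUnramifiedIn (𝓞 E) v.asIdeal)
    (hP : ∀ w : HeightOneSpectrum (𝓞 E), w.asIdeal.under (𝓞 F) = v.asIdeal → P.IsUnramifiedAt w) :
    π.IsUnramifiedAt v := by
  obtain ⟨χπ, hχπ⟩ := π.exists_heckeCharacter_glOne
  obtain ⟨χP, hχP⟩ := P.exists_heckeCharacter_glOne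
  have hbc : χP = χπ.baseChange E :=
    AutomorphicRepData.heckeCharacter_eq_baseChange_of_isWeakBaseChangeLiftAE_glOne hχπ hχP hBC
  have hur : χπ.IsUnramifiedAt v := by
    refine χπ.isUnramifiedAt_of_baseChange hvE fun w hw => ?_
    rw [← hbc]
    obtain ⟨β, hβ⟩ := hP w (under_eq_iff_asIdeal.mp hw)
    exact P.isUnramifiedAt_heckeCharacter_glOne hχP hβ
  exact ⟨_, π.hasSatakeParamAt_glOne_of_isUnramifiedAt hχπ hur
    (HeckeCharacter.valued_uniformizer (K := F) v)⟩

/-- **Arthur–Clozel's strong lifting at the unramified places, case `n = 1` (proved).**  The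
literal rank-one instance of the named fact `ArthurClozel1989_strongLifting_unramified`
(`BaseChangeStrongUnramified`; Arthur–Clozel, Ann. of Math. Stud. 120, Ch. 3, Thm. 5.1 with §1
(1.1), Def. 1.1–1.2 and Ch. 1 §6): for `E/F` Galois of prime degree and cuspidal data `π` on
`GL₁(𝔸_F)`, `Π` on `GL₁(𝔸_E)` with `Π` a weak base-change lift of `π`, (i) `Π` is an unramified
strong lift of `π` and (ii) at `v` unramified in `E`, `π` is unramified at `v` as soon as `Π` is
unramified at every `w ∣ v`.  (Cuspidality and the prime degree are not needed in rank one; for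
`GL(1)`, Ch. 1 Def. 6.1 reads `Π_w = π_v ∘ N_{E_w/F_v}` and a weak lift has Hecke character
`χ_Π = χ_π ∘ N_{E/F}` by the rigidity of Hecke characters.)
[cite: ArthurClozelAMS120, Ch. 3 Thm. 5.1 with §1 (1.1) and Def. 1.1–1.2; Ch. 1 Def. 6.1, Prop. 6.7] -/
theorem ArthurClozel1989_strongLifting_unramified.rank_one
    (F E : Type) [Field F] [NumberField F] [Field E] [NumberField E] [Algebra F E] [IsGalois F E]
    (_hprime : (Module.finrank F E).Prime)
    (hF : isCompact_glFiniteIntegralLevel 1 F) (hE : isCompact_glFiniteIntegralLevel 1 E)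
    (π : CuspidalAutomorphicRepData 1 F hF) (P : CuspidalAutomorphicRepData 1 E hE)
    (hBC : IsWeakBaseChangeLiftAE π.1 P.1) :
    IsUnramifiedBaseChangeLift π.1 P.1 ∧
      ∀ v : HeightOneSpectrum (𝓞 F), Algebra.IsUnramifiedIn (𝓞 E) v.asIdeal →
        (∀ w : HeightOneSpectrum (𝓞 E), w.asIdeal.under (𝓞 F) = v.asIdeal → P.1.IsUnramifiedAt w) →
          π.1.IsUnramifiedAt v :=
  ⟨π.1.isUnramifiedBaseChangeLift_of_isWeakBaseChangeLiftAE_glOne P.1 hBC,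
    fun _ hv hP => π.1.isUnramifiedAt_of_isWeakBaseChangeLiftAE_glOne P.1 hBC hv hP⟩

end RankOne

end Literature.NumberTheory.Automorphic
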